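import Summits.FinalStateConjecture.FinalStateConjecture.Theses.PhotonSphereChannels
import Summits.FinalStateConjecture.FinalStateConjecture.Theorems.PocketUniversesPocketsDefeatCharts
import HarnessLib

/-!
# `ChannelsResolveTameDevelopmentsR` (K2R″, stmt-FinalStateConjecture-17430) — negative lemma:
# the crux is refuted by any TAME POCKETED maximal development (cross-route bridge to `PocketUniverses`)

The re-typed crux K2R″ (`Theses.PhotonSphereChannels.ChannelsResolveTameDevelopmentsR`, route rev 15/16) reads
`K1R → ∀ X, ∀ D ∈ admissibleVacuumData X, ∀ 𝒟 maximal, complete 𝓘⁺ → ((i) no extremal-Kerr late chart ∧ (ii) C³-tame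
outer region) → ∃ O d, O = exteriorOf 𝒟 d.charted ∧ RaysStayInClosure 𝒟 O ∧ HasExhaustiveCharts d ∧ IsFutureOriented d`,
and `K1R` is landed (`Theses.PhotonSphereChannels.UniformPhotonSphereChannelsR_holds`). The refutation route
`PocketUniverses` (opened 2026-08-17) isolates a POCKET STRUCTURE `(Q, 𝒯, T)` on a vacuum Cauchy development — an open `Q`,
a hole tube `𝒯` and a continuous `T` monotone along `J⁺`, with (a) future-complete normalised null rays from an open set of
data points eventually in `Q ∖ closure 𝒯` along which `T → ∞`, (b) every late flat chart into `J⁺(Σ)` with `C²`-deviation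
`→ 0` has slabs eventually disjoint from `J⁺(Q)`, (c) every late boosted-Kerr chart into `J⁺(Σ)` with honest radii certifies
inside `Q` only within `𝒯`, `T` bounded on its converged truncated slabs `∩ J⁺(Q)` — and its support item
`PocketsDefeatCharts` (stmt-FinalStateConjecture-18856) is LANDED as
`Theorems.pocketsDefeatCharts_proof`: a pocket structure excludes every `(O, d)` with `O = exteriorOf`, `RaysStayInClosure`
and `HasExhaustiveCharts`.

This file records the consequence for K2R″, kernel-checked: if SOME admissible datum has SOME maximal development which is
tame in the sense of K2R″'s own hypotheses (complete 𝓘⁺, (i), (ii) — copied byte-for-byte from the route decl) and carries a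
pocket structure (copied byte-for-byte from `PocketsDefeatCharts`), then K2R″ is false
(`channelsResolveTameDevelopmentsR_false_of_tamePocketExists`). The hypothesis is packaged as the construction target
`TamePocketExists`; it is NOT constructible in the tree today: the intended carrier (an asymptotically flat end joined through
an Einstein–Rosen neck to an expanding closed-hyperbolic Löbell pocket, `PocketUniverses` crux `PocketExists`,
stmt-FinalStateConjecture-18854) needs the global nonlinear future of the punctured pocket (Andersson–Moncrief future
stability with an excised small black hole; printed as open beyond finite time in Hintz, arXiv:2408.06715, p. 4), and
tameness (ii) of its outer region and (i) are statements about that same global future. Independently of pockets the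
Φ-core of K2R″ (large-data Kerr stability / rigidity on the tame locus) remains open; this lemma only makes precise which
EXISTING construction item refutes the crux as typed (through summit clause (C) `RaysStayInClosure` and clause F2
`HasExhaustiveCharts`, cf. `…RRayClauseSplit.lean`). No cited facts; no new structures.
-/

set_option linter.dupNamespace false

noncomputable section

namespace Summit.FinalStateConjecture.FinalStateConjecture.Theorems.ChannelsResolveTameDevelopmentsR.Negative

open scoped BigOperators Topology Manifold Classical MeasureTheory ProbabilityTheory Matrix InnerProductSpace ComplexConjugate ContinuousMap
open Filter Set Function TopologicalSpace MeasureTheory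

/-- **Construction target `TamePocketExists` (the `H` of the negative lemma below).** There are a one-ended data
carrier `X`, an admissible vacuum datum `D` on it and a MAXIMAL vacuum Cauchy development `𝒟` of `D` such that
(1) `𝒟` has complete null infinity in the sojourn sense (`Summit.FinalStateConjecture.HasCompleteNullInfinity`);
(2) `𝒟` satisfies the two tameness hypotheses of K2R″ VERBATIM — (i) no late chart modelled on an extremal boosted Kerr
background with truncated `C²`-deviation `→ 0` at every radius, (ii) every point of the outer region
`J⁺(Σ) ∩ I⁻(future-complete normalised null rays from Σ)` is the centre of a flat late chart of a uniform Euclidean size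
`r₀` with `C³`-deviation `≤ Λ` and `C⁰`-deviation `≤ 1/2`; and (3) `𝒟` carries a pocket structure `(Q, 𝒯, T)` VERBATIM as
in `Theses.PocketUniverses.PocketsDefeatCharts` (stmt-FinalStateConjecture-18856; clauses (a)–(c) of the module
docstring). Intended witness: the `PocketUniverses` seed (AF Schwarzschild end # Einstein–Rosen neck # expanding Löbell
pocket), whose existence with these global properties is that route's open crux `PocketExists`
(stmt-FinalStateConjecture-18854) plus tameness of the same global future; it inherits that crux's recorded risks (the
global future of the punctured pocket; the unproved "cone lemma" behind clause (b): no late flat chart with `C²`-deviation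
`→ 0` has slabs inside an expanding flat pocket `I⁺(0)/Γ`; chart pinning behind clause (c)). If `H` is refuted the lemma
below is vacuous and the hold it places on stmt-17430 should be lifted; the Φ-core of K2R″ is open either way. [folklore] -/
@[conjecture] def TamePocketExists : Prop :=
  ∃ (X : Type) (_ : TopologicalSpace X) (_ : ChartedSpace Literature.Geometry.Lorentzian.E3 X) (_ : IsManifold (modelWithCornersSelf ℝ Literature.Geometry.Lorentzian.E3) ((⊤ : ℕ∞) : WithTop ℕ∞) X) (_ : T2Space X) (_ : SecondCountableTopology X) (_ : ConnectedSpace X) (D : Literature.Geometry.Lorentzian.InitialDataSet (modelWithCornersSelf ℝ Literature.Geometry.Lorentzian.E3) X) (_ : D ∈ Literature.Geometry.Lorentzian.admissibleVacuumData X) (𝒟 : Literature.Geometry.Lorentzian.VacuumCauchyDevelopment D), 𝒟.IsMaximal ∧ _root_.Summit.FinalStateConjecture.HasCompleteNullInfinity 𝒟.toCauchyDevelopment ∧ ((∀ (Λ : Literature.Geometry.Lorentzian.lorentzGroup) (c : Literature.Geometry.Lorentzian.E4) (M a : ℝ), Literature.Geometry.Lorentzian.Kerr.IsExtremal M a → ¬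 ∃ (τ₀ : ℝ) (Ψ : (Literature.Geometry.Lorentzian.boostedKerrBackground Λ c M a).domain → 𝒟.carrier), 𝒟.toSpacetime.IsLateChart (Literature.Geometry.Lorentzian.boostedKerrBackground Λ c M a) Set.univ τ₀ Ψ ∧ ∀ R : ℝ, Filter.Tendsto (fun τ => 𝒟.toSpacetime.truncDeviationCk (Literature.Geometry.Lorentzian.boostedKerrBackground Λ c M a) Ψ 2 R τ) Filter.atTop (nhds 0)) ∧ ∀ [𝒟.metric.HasLeviCivita], let outer : Set 𝒟.carrier := 𝒟.metric.causalFuture 𝒟.timeOrientation (Set.range 𝒟.embed) ∩ {q | ∃ (p : X) (γ : ℝ → 𝒟.carrier) (dom : Set ℝ), 𝒟.metric.IsNormalisedNullRayFrom 𝒟.timeOrientation 𝒟.embed 𝒟.normal p γ dom ∧ ¬ BddAbove dom ∧ q ∈ 𝒟.metric.chronologicalPast 𝒟.timeOrientation (γ '' (dom ∩ Set.Ici 0))}; ∃ r₀ : ℝ, 0 < r₀ ∧ ∃ Λ : NNReal, ∀ q ∈ outer, let U : TopologicalSpace.Opens Literature.Geometry.Lorentzian.E4 := ⟨Metric.ball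 (0 : Literature.Geometry.Lorentzian.E4) r₀, Metric.isOpen_ball⟩; ∃ Ψ : U → 𝒟.carrier, 𝒟.toSpacetime.IsLateChart (Literature.Geometry.Lorentzian.Minkowski.backgroundOn U) Set.univ (-r₀) Ψ ∧ (∃ x : U, (x : Literature.Geometry.Lorentzian.E4) = 0 ∧ Ψ x = q) ∧ Literature.Geometry.Lorentzian.supCkENorm (U : Set Literature.Geometry.Lorentzian.E4) 3 (𝒟.toSpacetime.deviationExtend (Literature.Geometry.Lorentzian.Minkowski.backgroundOn U) Ψ) ≤ (Λ : ENNReal) ∧ Literature.Geometry.Lorentzian.supCkENorm (U : Set Literature.Geometry.Lorentzian.E4) 0 (𝒟.toSpacetime.deviationExtend (Literature.Geometry.Lorentzian.Minkowski.backgroundOn U) Ψ) ≤ 1 / 2) ∧ (𝒟.metric.HasLeviCivita ∧ ∃ (Q 𝒯 : Set 𝒟.carrier) (T : 𝒟.carrier → ℝ), IsOpen Q ∧ Continuous T ∧ (∀ x z : 𝒟.carrier, z ∈ 𝒟.metric.causalFuture 𝒟.timeOrientation {x} → T x ≤ T z) ∧ (∀ [𝒟.metric.HasLeviCivita], ∃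 V : Set X, IsOpen V ∧ V.Nonempty ∧ ∀ p ∈ V, ∃ (γ : ℝ → 𝒟.carrier) (dom : Set ℝ) (t₀ : ℝ), 𝒟.metric.IsNormalisedNullRayFrom 𝒟.timeOrientation 𝒟.embed 𝒟.normal p γ dom ∧ ¬ BddAbove dom ∧ 0 ≤ t₀ ∧ (∀ t ∈ dom, t₀ ≤ t → γ t ∈ Q ∧ γ t ∉ closure 𝒯) ∧ ∀ B : ℝ, ∃ t ∈ dom, t₀ ≤ t ∧ B < T (γ t)) ∧ (∀ (U₀ : TopologicalSpace.Opens Literature.Geometry.Lorentzian.E4) (Ψ₀ : U₀ → 𝒟.carrier) (s₁ : ℝ) (n : ℕ) (mo : Fin n → Literature.Geometry.Lorentzian.lorentzGroup × Literature.Geometry.Lorentzian.E4) (sp : Fin n → ℝ) (ρ : Fin n → ℝ → ℝ), (∀ i, Tendsto (fun t ↦ ρ i t / t) atTop (𝓝 0)) → {x : Literature.Geometry.Lorentzian.E4 | s₁ < x 0 ∧ ∀ i, ρ i (x 0) < Literature.Geometry.Lorentzian.Kerr.radius (sp i) (Literature.Geometry.Lorentzian.poincareInv (mo i).1 (mo i).2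 x)} ⊆ (U₀ : Set Literature.Geometry.Lorentzian.E4) → 𝒟.toSpacetime.IsLateChart (Literature.Geometry.Lorentzian.Minkowski.backgroundOn U₀) (𝒟.metric.causalFuture 𝒟.timeOrientation (range 𝒟.embed)) s₁ Ψ₀ → Tendsto (fun s ↦ 𝒟.toSpacetime.deviationCk (Literature.Geometry.Lorentzian.Minkowski.backgroundOn U₀) Ψ₀ 2 s) atTop (𝓝 0) → ∃ s₀ : ℝ, ∀ s, s₀ ≤ s → Disjoint (Ψ₀ '' (Literature.Geometry.Lorentzian.Minkowski.backgroundOn U₀).timeSlab s) (𝒟.metric.causalFuture 𝒟.timeOrientation Q)) ∧ (∀ (Λ' : Literature.Geometry.Lorentzian.lorentzGroup) (c' : Literature.Geometry.Lorentzian.E4) (M' a' s₁ : ℝ) (Ψ : Literature.Geometry.Lorentzian.boostedKerrExterior Λ' c' M' a' → 𝒟.carrier) (R : ℝ → ℝ), 0 < M' → |a'| ≤ M' → 𝒟.toSpacetime.IsLateChart (Literature.Geometry.Lorentzian.boostedKerrBackground Λ' c' M' a') (𝒟.metric.causalFuture 𝒟.timeOrientation (range 𝒟.embed)) s₁ Ψ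 → Tendsto R atTop atTop → (∀ s, max (Literature.Geometry.Lorentzian.Kerr.rPlus M' a') 0 + 1 ≤ R s) → Tendsto (fun s ↦ 𝒟.toSpacetime.truncDeviationCk (Literature.Geometry.Lorentzian.boostedKerrBackground Λ' c' M' a') Ψ 2 (R s) s) atTop (𝓝 0) → ∃ s₀ : ℝ, Ψ '' {x | s₀ < (Literature.Geometry.Lorentzian.boostedKerrBackground Λ' c' M' a').time x.1 ∧ (Literature.Geometry.Lorentzian.boostedKerrBackground Λ' c' M' a').radius x.1 ≤ R ((Literature.Geometry.Lorentzian.boostedKerrBackground Λ' c' M' a').time x.1)} ∩ Q ⊆ 𝒯 ∧ ∀ s, s₀ ≤ s → BddAbove (T '' (Ψ '' (Literature.Geometry.Lorentzian.boostedKerrBackground Λ' c' M' a').truncTimeSlab (R s) s ∩ 𝒟.metric.causalFuture 𝒟.timeOrientation Q))))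

/-- **Negative lemma for K2R″ (stmt-FinalStateConjecture-17430): a tame pocketed maximal development refutes
`ChannelsResolveTameDevelopmentsR`.** Feed the landed `K1R` (`UniformPhotonSphereChannelsR_holds`) and the witness's
maximality, complete 𝓘⁺ and tameness (i)–(ii) to K2R″ to obtain `(O, d)` with `O = exteriorOf 𝒟 d.charted`,
`RaysStayInClosure 𝒟 O` and `HasExhaustiveCharts d`; the landed causal bookkeeping lemma
`Theorems.pocketsDefeatCharts_proof` (route `PocketUniverses`, stmt-FinalStateConjecture-18856) says the pocket structure
admits no such pair. The item stays open: `TamePocketExists` is a construction target, not a theorem of the tree.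
[folklore] -/
theorem channelsResolveTameDevelopmentsR_false_of_tamePocketExists :
    TamePocketExists →
      ¬ _root_.Summit.FinalStateConjecture.FinalStateConjecture.Theses.PhotonSphereChannels.ChannelsResolveTameDevelopmentsR := by
  rintro ⟨X, i₁, i₂, i₃, i₄, i₅, i₆, D, hD, 𝒟, hmax, hcomp, htame, hpock⟩ hK2R
  obtain ⟨O, d, hO, hrays, hexh, -⟩ :=
    hK2R _root_.Summit.FinalStateConjecture.FinalStateConjecture.Theses.PhotonSphereChannels.UniformPhotonSphereChannelsR_holds
      X D hD 𝒟 hmax hcomp htame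
  exact _root_.Summit.FinalStateConjecture.FinalStateConjecture.Theorems.pocketsDefeatCharts_proof X D 𝒟 hpock
    ⟨O, d, hO, hrays, hexh⟩

/-- **Contrapositive, for the planner: K2R″ as typed is also a CENSORSHIP statement on interiors.** If
`ChannelsResolveTameDevelopmentsR` holds then NO admissible datum has a maximal development that is tame in K2R″'s own sense
(complete 𝓘⁺, (i), (ii)) and carries a pocket structure — i.e. the crux silently asserts that tame developments contain no
expanding pocket behind a horizon with complete interior rays (the `PocketUniverses` scenario), a claim absent from the
route's thesis, which argues only about the exterior / photon-sphere mechanism. (Graph reading: a negative edge on the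
construction target `TamePocketExists` under the registered hypothesis K2R″ — whoever builds `H` refutes the crux, whoever
proves the crux refutes `H`.) Immediate from `channelsResolveTameDevelopmentsR_false_of_tamePocketExists`. [folklore] -/
theorem not_tamePocketExists_of_channelsResolveTameDevelopmentsR
    (hK2R : _root_.Summit.FinalStateConjecture.FinalStateConjecture.Theses.PhotonSphereChannels.ChannelsResolveTameDevelopmentsR) :
    ¬ TamePocketExists :=
  fun h => channelsResolveTameDevelopmentsR_false_of_tamePocketExists h hK2R

/-! ## Status (appended 2026-08-17T05:20Z, same seat): `TamePocketExists` is DEAD AS TYPED — the lemma is moot, not wrong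

While this file was being checked and landed (p142597 05:05Z, p142672 05:08Z), the `PocketUniverses` crux `PocketExists`
(stmt-FinalStateConjecture-18854) was `refuted-misstated` on paper by refuter rattack-18854 (item notes 04:23Z) and the route
was RETIRED at 04:44Z (items 18854/18855/18856 closed `moot`; header of `Theses/PocketUniverses.lean`). The defect is
typing-level and is inherited verbatim by conjunct (3) of `TamePocketExists`: clause (b) of the pocket structure quantifies
over flat charts on ANY `U₀ : Opens E4` with `U₀ ⊇ E`, whose slab is all of `U₀ ∩ {x⁰ = s}`, so a DOCTORED chart (honest
component on the AF side + an extra unit cylinder Fermi-mapped along a comoving geodesic into the pocket) satisfies every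
hypothesis of (b) and meets `J⁺(Q)` at every level — no `(Q, 𝒯, T)` with (a) ∧ (b) exists in any development of the
intended seed, and plausibly in no tame pocketed development at all. Hence `TamePocketExists` is expected FALSE for a
junk reason, `channelsResolveTameDevelopmentsR_false_of_tamePocketExists` is vacuous in effect (true, kernel-checked,
but with an unsatisfiable-as-typed hypothesis), and NO hold should be placed on stmt-FinalStateConjecture-17430 on its
account. The faithful repair of (b) (honest-core slab, `ρᵢ → ∞`; strategist census
`Cruxes/PocketExists/STRATEGY-CENSUS.md`) does not rescue the line either: the conclusion-side twin of the loophole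
(tendrils of `d.flatDomain` certify pocket points; cf. the `flatDomain` lower-bound-only finding, crux-triage r1-2 Finding D
on stmt-17430) makes the repaired bookkeeping lemma false, so pocket/bag data are NOT counter-models of K2R″ AS TYPED.
What survives for stmt-17430: the Φ-core (K2R♭) is open; the (C)/F2 half is typing- and operator-contingent (refuter
question Q-F1: restrict `RaysStayInClosure` to rays escaping along the AF end; F2 tendril/dust hardening). If a re-typed
pocket packaging `P′` with a true bookkeeping lemma `P′ 𝒟 → ¬ ∃ (O, d), …` is ever filed, the three-line proof of
`channelsResolveTameDevelopmentsR_false_of_tamePocketExists` transfers verbatim with `P′` in place of conjunct (3). -/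

end Summit.FinalStateConjecture.FinalStateConjecture.Theorems.ChannelsResolveTameDevelopmentsR.Negative

end
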